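import Mathlib
import Summits.Ventures.PercRepro2.Harris
import Summits.Ventures.PercRepro2.HCov
import Summits.Ventures.PercRepro2.SepZero
import Summits.Ventures.PercRepro2.SepPairBridge
import Summits.Ventures.PercRepro2.SepTwoBlocks

/-!
# The (SEP-2) exact zero, II: `Gc = 0` whenever `{a₁, a₂}` separates `o` from `b`
(blind cell PercRepro2, typer-1 g49; LEAD-CYCLES.md §4, S3-CLASSES §S3.8 and (G7))

**Theorem (SEP-2).** Let `G` be any finite weighted graph and suppose every path from `o` to `b`
passes through `a₁` or `a₂` — `b` is not reached from `o` once every edge touching `{a₁, a₂}` is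
closed (`b ∉ K`, `K = C_{G − {a₁, a₂}}(o)`; mine-2's `Separates ends {a₁, a₂} o b`).  Then the
five-point functional vanishes, `Gc p ends o a₁ a₂ a₃ b = 0` (`Gc_eq_zero_of_sepPair`,
`Gc_eq_zero_of_separates`), so (HCOV) holds with equality on the class (`HCov_of_sepPair`,
`HCov_of_separates`) — for every admissible weight vector, every position of `a₃`, and without
any distinctness beyond `o ∉ {a₁, a₂}`.

**Proof** (the lead's paper proof, LEAD-CYCLES §4, cleared of divisions).  With the product law
of `SepTwoBlocks.lean`, the twenty-two masses of `Gc` carrying both an `o`-factor and a `b`- or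
`a₃`-factor factorise across the pair; `P(Q) · Gc = 0` is then one `linear_combination` of these
factorisations in either block position of `a₃` (`mul_Gc_eq_zero_of_not_mem`,
`mul_Gc_eq_zero_of_mem`), and `P(Q) = 0` kills every mass directly (`Gc_eq_zero_of_Q_null`).
In the language of LEAD-CYCLES §4: `Cov_Q(σ_b, F) = (γ − P_Q(o ∈ U)) · Cov_Q(σ_b, σ₃) = 0`
and `Cov_PD(1_{b∈U}, 1_{o∈U}) = 0`.  No Harris / BHK input.  Own work; standard axioms.
-/

namespace Summit.Ventures.PercRepro2

namespace SepTwoGcZero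

open CovForm SepPair SepZero

/-! ## The theorem -/

section Theorem

variable {V : Type*} {E : Type*} [Fintype E] [DecidableEq E] {R : Type*}
  [Field R] [LinearOrder R] [IsStrictOrderedRing R]

/-- `Gc = 0` when `Q` is null (every mass of `Gc` but the gap is a sub-event of `Q`). -/
theorem Gc_eq_zero_of_Q_null {p : E → R} (hp : IsProbVec p) (ends : E → Sym2 V)
    (o a₁ a₂ a₃ b : V) (hQ : prob p (avoidAll ends a₂ {a₁}) = 0) :
    Gc p ends o a₁ a₂ a₃ b = 0 := by
  have hz : ∀ X : Set (Config E), X ⊆ avoidAll ends a₂ {a₁} → prob p X = 0 := fun X hX =>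
    le_antisymm ((prob_mono hp hX).trans hQ.le) (prob_nonneg hp X)
  have hQZ : ∀ Z : Set (Config E), prob p (avoidAll ends a₂ {a₁} ∩ Z) = 0 := fun Z =>
    hz _ Set.inter_subset_left
  have hTZ : ∀ Z : Set (Config E), prob p (TEvent ends a₁ a₂ a₃ ∩ Z) = 0 := fun Z =>
    hz _ (Set.inter_subset_left.trans T_subset_Q)
  have hT'Z : ∀ Z : Set (Config E), prob p (TEvent ends a₂ a₁ a₃ ∩ Z) = 0 := fun Z =>
    hz _ (Set.inter_subset_left.trans T'_subset_Q)
  have hPDZ : ∀ Z : Set (Config E), prob p (PDEvent ends a₁ a₂ a₃ ∩ Z) = 0 := fun Z =>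
    hz _ (Set.inter_subset_left.trans PD_subset_Q)
  have hT : prob p (TEvent ends a₁ a₂ a₃) = 0 := hz _ T_subset_Q
  have hT' : prob p (TEvent ends a₂ a₁ a₃) = 0 := hz _ T'_subset_Q
  have hPD : prob p (PDEvent ends a₁ a₂ a₃) = 0 := hz _ PD_subset_Q
  unfold Gc DEF EQbo EQb3 EQb3o EQo EQ3 EQ3o PDb PDbo Do
  simp only [hQZ, hTZ, hT'Z, hPDZ, hT, hT', hPD, hQ]
  ring

/-- **(SEP-2), `a₃` outside the root's component**: with `b ∉ K` and `a₃ ∉ K`, `P(Q) · Gc = 0`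
(the twenty-two factorisations of `mass_split` and one `linear_combination`). -/
theorem mul_Gc_eq_zero_of_not_mem (p : E → R) (ends : E → Sym2 V) {o a₁ a₂ a₃ b : V}
    (ho : o ∉ ({a₁, a₂} : Set V)) (hb : b ∉ cluster ends (sepConfig ends {a₁, a₂}) o)
    (h₃ : a₃ ∉ cluster ends (sepConfig ends {a₁, a₂}) o) :
    prob p (avoidAll ends a₂ {a₁}) * Gc p ends o a₁ a₂ a₃ b = 0 := by
  classical
  -- the block data
  have hoK : o ∈ cluster ends (sepConfig ends {a₁, a₂}) o := mem_cluster_self _ _ _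
  have hoL := detOn_connEvent_of_mem ho hoK (Or.inl rfl)
  have hoH := detOn_connEvent_of_mem ho hoK (Or.inr rfl)
  have hbL := detOn_connEvent_of_not_mem ho hb (Or.inl rfl)
  have hbH := detOn_connEvent_of_not_mem ho hb (Or.inr rfl)
  have hQ' : DetOn ends a₁ a₂ (touches ends (cluster ends (sepConfig ends {a₁, a₂}) o))ᶜ
    (avoidAll ends a₂ {a₁}) := detOn_Q
  have hT := detOn_T_of_not_mem ho h₃
  have hT' := detOn_T'_of_not_mem ho h₃
  have hPD := detOn_PD_of_not_mem ho h₃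
  -- the twenty-two factorisations
  have q1 := mass_split p ho subset_rfl hQ' hoL hbL
  have q2 := mass_split p ho subset_rfl hQ' hoH hbH
  have q3 := mass_split p ho subset_rfl hQ' hoH hbL
  have q4 := mass_split p ho subset_rfl hQ' hoL hbH
  have t1 := mass_split p ho T'_subset_Q hT' hoL hbL
  have t2 := mass_split p ho T'_subset_Q hT' hoH hbL
  have t3 := mass_split p ho T_subset_Q hT hoL hbH
  have t4 := mass_split p ho T_subset_Q hT hoH hbH
  have t5 := mass_split p ho T_subset_Q hT hoL hbL
  have t6 := mass_split p ho T_subset_Q hT hoH hbL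
  have t7 := mass_split p ho T'_subset_Q hT' hoL hbH
  have t8 := mass_split p ho T'_subset_Q hT' hoH hbH
  have s1 := mass_split_one p ho T'_subset_Q hT' hoL
  have s2 := mass_split_one p ho T'_subset_Q hT' hoH
  have s3 := mass_split_one p ho T_subset_Q hT hoL
  have s4 := mass_split_one p ho T_subset_Q hT hoH
  have d1 := mass_split_one p ho PD_subset_Q hPD hoL
  have d2 := mass_split_one p ho PD_subset_Q hPD hoH
  have e1 := mass_split p ho PD_subset_Q hPD hoL hbL
  have e2 := mass_split p ho PD_subset_Q hPD hoH hbL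
  have e3 := mass_split p ho PD_subset_Q hPD hoL hbH
  have e4 := mass_split p ho PD_subset_Q hPD hoH hbH
  unfold Gc DEF EQbo EQb3 EQb3o EQo EQ3 EQ3o PDb PDbo Do
  rw [gap_eq_Q]
  set q := prob p (avoidAll ends a₂ {a₁}) with hq
  set D := prob p (PDEvent ends a₁ a₂ a₃) with hD
  set vL := prob p (avoidAll ends a₂ {a₁} ∩ connEvent ends a₁ b) with hvL
  set vH := prob p (avoidAll ends a₂ {a₁} ∩ connEvent ends a₂ b) with hvH
  set n1 := prob p (TEvent ends a₂ a₁ a₃ ∩ connEvent ends a₁ b) with hn1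
  set n2 := prob p (TEvent ends a₁ a₂ a₃ ∩ connEvent ends a₂ b) with hn2
  set n3 := prob p (TEvent ends a₁ a₂ a₃ ∩ connEvent ends a₁ b) with hn3
  set n4 := prob p (TEvent ends a₂ a₁ a₃ ∩ connEvent ends a₂ b) with hn4
  set t := prob p (TEvent ends a₁ a₂ a₃) with ht
  set t' := prob p (TEvent ends a₂ a₁ a₃) with ht'
  set g1 := prob p (PDEvent ends a₁ a₂ a₃ ∩ connEvent ends a₁ b) with hg1
  set g2 := prob p (PDEvent ends a₁ a₂ a₃ ∩ connEvent ends a₂ b) with hg2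
  linear_combination
    q * D * (q1 + q2 - q3 - q4)
    + (q * (n1 + n2 - n3 - n4) + (vH - vL) * (t' - t) + q * (g1 + g2)) * (d1 + d2)
    - q * D * (t1 + t2 + t3 + t4 - t5 - t6 - t7 - t8)
    - (vH - vL) * D * (s1 + s2 - s3 - s4)
    - q * D * (e1 + e2 + e3 + e4)

/-- **(SEP-2), `a₃` in the root's component**: with `b ∉ K` and `a₃ ∈ K`, `P(Q) · Gc = 0`
(the twenty-two factorisations of `mass_split'` and one `linear_combination`). -/
theorem mul_Gc_eq_zero_of_mem (p : E → R) (ends : E → Sym2 V) {o a₁ a₂ a₃ b : V}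
    (ho : o ∉ ({a₁, a₂} : Set V)) (hb : b ∉ cluster ends (sepConfig ends {a₁, a₂}) o)
    (h₃ : a₃ ∈ cluster ends (sepConfig ends {a₁, a₂}) o) :
    prob p (avoidAll ends a₂ {a₁}) * Gc p ends o a₁ a₂ a₃ b = 0 := by
  classical
  -- the block data
  have hoK : o ∈ cluster ends (sepConfig ends {a₁, a₂}) o := mem_cluster_self _ _ _
  have hoL := detOn_connEvent_of_mem ho hoK (Or.inl rfl)
  have hoH := detOn_connEvent_of_mem ho hoK (Or.inr rfl)
  have hbL := detOn_connEvent_of_not_mem ho hb (Or.inl rfl)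
  have hbH := detOn_connEvent_of_not_mem ho hb (Or.inr rfl)
  have hQ' : DetOn ends a₁ a₂ (touches ends (cluster ends (sepConfig ends {a₁, a₂}) o))
    (avoidAll ends a₂ {a₁}) := detOn_Q
  have hT := detOn_T_of_mem ho h₃
  have hT' := detOn_T'_of_mem ho h₃
  have hPD := detOn_PD_of_mem ho h₃
  -- the twenty-two factorisations
  have q1 := mass_split' p ho subset_rfl hQ' hoL hbL
  have q2 := mass_split' p ho subset_rfl hQ' hoH hbH
  have q3 := mass_split' p ho subset_rfl hQ' hoH hbL
  have q4 := mass_split' p ho subset_rfl hQ' hoL hbH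
  have t1 := mass_split' p ho T'_subset_Q hT' hoL hbL
  have t2 := mass_split' p ho T'_subset_Q hT' hoH hbL
  have t3 := mass_split' p ho T_subset_Q hT hoL hbH
  have t4 := mass_split' p ho T_subset_Q hT hoH hbH
  have t5 := mass_split' p ho T_subset_Q hT hoL hbL
  have t6 := mass_split' p ho T_subset_Q hT hoH hbL
  have t7 := mass_split' p ho T'_subset_Q hT' hoL hbH
  have t8 := mass_split' p ho T'_subset_Q hT' hoH hbH
  have b1 := mass_split_one' p ho T'_subset_Q hT' hbL
  have b2 := mass_split_one' p ho T_subset_Q hT hbH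
  have b3 := mass_split_one' p ho T_subset_Q hT hbL
  have b4 := mass_split_one' p ho T'_subset_Q hT' hbH
  have p1 := mass_split_one' p ho PD_subset_Q hPD hbL
  have p2 := mass_split_one' p ho PD_subset_Q hPD hbH
  have e1 := mass_split' p ho PD_subset_Q hPD hoL hbL
  have e2 := mass_split' p ho PD_subset_Q hPD hoH hbL
  have e3 := mass_split' p ho PD_subset_Q hPD hoL hbH
  have e4 := mass_split' p ho PD_subset_Q hPD hoH hbH
  unfold Gc DEF EQbo EQb3 EQb3o EQo EQ3 EQ3o PDb PDbo Do
  rw [gap_eq_Q]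
  set q := prob p (avoidAll ends a₂ {a₁}) with hq
  set D := prob p (PDEvent ends a₁ a₂ a₃) with hD
  set c1 := prob p (PDEvent ends a₁ a₂ a₃ ∩ connEvent ends a₁ o) with hc1
  set c2 := prob p (PDEvent ends a₁ a₂ a₃ ∩ connEvent ends a₂ o) with hc2
  linear_combination
    q * D * (q1 + q2 - q3 - q4)
    + q * (c1 + c2) * (b1 + b2 - b3 - b4)
    - q * D * (t1 + t2 + t3 + t4 - t5 - t6 - t7 - t8)
    + q * (c1 + c2) * (p1 + p2)
    - q * D * (e1 + e2 + e3 + e4)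

/-- **(SEP-2)** — `Gc = 0` whenever `b` is not reached from `o` in `G − {a₁, a₂}` (every
`o`–`b` path passes through a root), for every admissible weight vector and every `a₃`. -/
theorem Gc_eq_zero_of_sepPair {p : E → R} (hp : IsProbVec p) (ends : E → Sym2 V)
    {o a₁ a₂ : V} (a₃ b : V) (ho : o ∉ ({a₁, a₂} : Set V))
    (hb : b ∉ cluster ends (sepConfig ends {a₁, a₂}) o) :
    Gc p ends o a₁ a₂ a₃ b = 0 := by
  by_cases hQ : prob p (avoidAll ends a₂ {a₁}) = 0
  · exact Gc_eq_zero_of_Q_null hp ends o a₁ a₂ a₃ b hQ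
  · by_cases h₃ : a₃ ∈ cluster ends (sepConfig ends {a₁, a₂}) o
    · exact (mul_eq_zero.1 (mul_Gc_eq_zero_of_mem p ends ho hb h₃)).resolve_left hQ
    · exact (mul_eq_zero.1 (mul_Gc_eq_zero_of_not_mem p ends ho hb h₃)).resolve_left hQ

/-- **(HCOV) with equality on the (SEP-2) class.** -/
theorem HCov_of_sepPair {p : E → R} (hp : IsProbVec p) (ends : E → Sym2 V)
    {o a₁ a₂ : V} (a₃ b : V) (ho : o ∉ ({a₁, a₂} : Set V))
    (hb : b ∉ cluster ends (sepConfig ends {a₁, a₂}) o) :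
    HCov p ends o a₁ a₂ a₃ b :=
  (Gc_eq_zero_of_sepPair hp ends a₃ b ho hb).symm.le

end Theorem

section Separates

variable {V : Type*} {E : Type*} [Fintype V] [DecidableEq V] [Fintype E] [DecidableEq E]
  {R : Type*} [Field R] [LinearOrder R] [IsStrictOrderedRing R]

/-- **(SEP-2) in mine-2's vocabulary**: `Separates ends {a₁, a₂} o b` (KN24's separating pair)
gives `Gc = 0`. -/
theorem Gc_eq_zero_of_separates {p : E → R} (hp : IsProbVec p) (ends : E → Sym2 V)
    {o a₁ a₂ : V} (a₃ b : V) (ho₁ : o ≠ a₁) (ho₂ : o ≠ a₂)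
    (hsep : Separates ends {a₁, a₂} o b) : Gc p ends o a₁ a₂ a₃ b = 0 :=
  Gc_eq_zero_of_sepPair hp ends a₃ b (by simp [ho₁, ho₂])
    (not_conn_sepConfig_of_separates hsep)

/-- **(HCOV) on the (SEP-2) class, `Separates` form.** -/
theorem HCov_of_separates {p : E → R} (hp : IsProbVec p) (ends : E → Sym2 V)
    {o a₁ a₂ : V} (a₃ b : V) (ho₁ : o ≠ a₁) (ho₂ : o ≠ a₂)
    (hsep : Separates ends {a₁, a₂} o b) : HCov p ends o a₁ a₂ a₃ b :=
  (Gc_eq_zero_of_separates hp ends a₃ b ho₁ ho₂ hsep).symm.le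

end Separates

end SepTwoGcZero

end Summit.Ventures.PercRepro2
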